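import Literature.Claims.NS.Nadirashvili2026
import Literature.Analysis.FunctionSpaces.TorusFourierModes
import Literature.Analysis.FunctionSpaces.TorusLinearisedNSEnergy
import Literature.Analysis.Calculus.ArchimedesProjection
import Mathlib.Analysis.Complex.Exponential
import HarnessLib

/-!
# Solo refutation companion (D-0090 NS-CLAIMS, C129): Nadirashvili, arXiv 2606.02811 v4 (2026) —
# Step 7 at the carrier (Galerkin) grain, `Step_SN1` = (5.13) p.35

Cell `ns-claims`, row C129 (ADJUDICATED #116; locator `Step_subsol` (5.18) p.36 unchanged).
File of record #3 (ADDENDUM, off the clock) of the refuter of record (ns-claims-refuter-5 g2);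
sibling of `Theorems/SoloRefuteNadirashvili2026.lean` (`not_Step_subsol`, (5.18) p.36) and
`Theorems/SoloRefuteNadirashvili2026SN1abs.lean` (`not_Step_SN1_abs`, (5.13) abstract face).
Imports the LANDED skeleton `Literature.Claims.NS.Nadirashvili2026` (p493920 @ 192b4a679bf1,
rev 2 p494606, rev 3 p497226) and the Archimedes-projection tool of ns-claims-lit-1 g7
(`Literature.Analysis.Calculus.hasDerivAt_integral_ball_sinh_sq_inner`, p497252).

Target: `Literature.Claims.NS.Nadirashvili2026.Step_SN1` — (5.13) p.35 l.14–22 [TeX l.1539–1544]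
«Assume that ∂⁵E(0,t₀)/∂r⁵ ≥ k, then from Lemma 5.5 and inequality (5.9) follows, that for
sufficiently large k E_r(1/k^{3/2}, t₀) > y′_k(1/k^{3/2})», typed at the grain Step 11 consumes:
for every energy bound `B ≥ 0` a threshold `k₀` beyond which EVERY Galerkin field `a`
(`IsGalerkinMode N a`, kinetic energy `≤ B`) with `d5 a = 32π‖∇a‖²_{L²} ≥ k` has
`y′_k(k^{−3/2}) < E′(k^{−3/2})`, `E(ρ) = cE N a ρ = ∫_{T³} ∫_{B_ρ} ‖Im W(x + iy)‖² dy dx`.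

Countermodel (this file, every threshold `k₀`, `B = 1`): the circularly polarised single Fourier
mode `a = A (sin 2πn x₃, cos 2πn x₃, 0)`, `A² = 1/(128π³)`, `n = M⁸`, `M = max(2, ⌈k₀⌉)`,
`k = M¹⁶`. It is a smooth divergence-free Galerkin mode of order `N = n` with kinetic energy
`A²/2 ≤ 1` and `d5 a = n² = k` EXACTLY; its holomorphic extension is two Fourier modes, so
`‖Im W(x + iy)‖² = A² sinh²(2πn y₃)` pointwise and `E(ρ) = A² ∫_{B_ρ} sinh²⟪y, κ⟫ dy`,
`κ = 2πn e₃`; the Archimedes projection gives `E′(δ) = A²·2πδ (sinh(4πnδ)/(4πn) − δ)`, and at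
`δ = k^{−3/2} = M^{−24}` (all real powers collapse: `δ^{33/8} = M^{−99}`)
`E′(δ) ≤ (k/24)δ⁴ + (π²/25)M^{−112} ≤ (k/24)δ⁴ + (41/8)δ^{33/8} = y′_k(δ)` — the claimed strict
inequality fails. Same mechanism as `not_Step_SN1_abs` (the inputs named on p.35 bound the
higher Taylor coefficients of `E` only at orders `k²δ⁶ ≪ δ^{33/8}`), now realised by an honest
Galerkin field, as announced in the VERDICT of record (STATUS 04:50:04Z: «carrier `Step_SN1` false
on paper, three-sourced: RETYPE §1 Finding A, REFUTER.md §2 F2, CARD §7»). The referee's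
charitable margin form (5.13)′ = `Step_513_margin` (TRUE per REF ref-3 g3) is not touched.

Decls: `sn1Freq`/`sn1Amp`/`sn1Vec`/`sn1Mode`/`sn1Kappa` (the witness), `isGalerkinMode_sn1Mode`,
`kineticEnergy_sn1Mode_le`, `d5_sn1Mode`, `holExt_sn1Mode`, `norm_sq_imExt_sn1Mode`, `cE_sn1Mode`,
`hasDerivAt_cE_sn1Mode`/`deriv_cE_sn1Mode`, `sinh_le_taylor`, `sn1_core`, `not_Step_SN1`.
Std axioms only.

WHAT THIS IS NOT: not a claim about NS regularity or blow-up; not a claim about any author beyond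
the typed locator.
-/

noncomputable section

-- lint debt (cell convention, SoloRefute files): the Theorems namespace repeats
-- `NavierStokesRegularity`.
set_option linter.dupNamespace false

open MeasureTheory Set Metric
open scoped InnerProductSpace RealInnerProductSpace ComplexConjugate

namespace Summit.NavierStokesRegularity.NavierStokesRegularity.Theorems.Nadirashvili2026

open Literature.Claims.NS.Nadirashvili2026
open Literature.Analysis.FunctionSpaces Literature.Analysis.FluidPDE

/-- Frequency `k₀ = n e₃ ∈ ℤ³` of the witness mode. [folklore] -/
def sn1Freq (n : ℕ) : Fin 3 → ℤ := fun j => if j = 2 then (n : ℤ) else 0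

/-- Amplitude `A = (128π³)^{-1/2}`, chosen so that `d5` of the mode is exactly `n²`.
[folklore] -/
def sn1Amp : ℝ := (Real.sqrt (128 * Real.pi ^ 3))⁻¹

/-- Polarisation vector `z = A · (−i, 1, 0) ∈ ℂ³` (circular, transversal to `e₃`).
[folklore] -/
def sn1Vec : C3 := WithLp.toLp 2 ![-((sn1Amp : ℂ) * Complex.I), (sn1Amp : ℂ), 0]

/-- The witness mode `a(x) = Re (e_{k₀}(x) • z) = A (sin 2πn x₃, cos 2πn x₃, 0)`.
[folklore] -/
def sn1Mode (n : ℕ) : T3 → E3 := Torus.realTrigPoly {sn1Freq n} fun _ => sn1Vec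

/-- `A² = 1/(128π³)`. [folklore] -/
theorem sn1Amp_sq : sn1Amp ^ 2 = (128 * Real.pi ^ 3)⁻¹ := by
  rw [sn1Amp, inv_pow, Real.sq_sqrt (by positivity)]

/-- `A > 0`. [folklore] -/
theorem sn1Amp_pos : 0 < sn1Amp := by
  rw [sn1Amp]; positivity

/-- `|k₀|² = n²`. [folklore] -/
theorem freqNormSq_sn1Freq (n : ℕ) : Torus.freqNormSq (sn1Freq n) = (n : ℝ) ^ 2 := by
  simp [Torus.freqNormSq, sn1Freq]

/-- `k₀ ∈` the frequency ball of order `n`. [folklore] -/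
theorem sn1Freq_mem_freqBall (n : ℕ) : sn1Freq n ∈ Torus.freqBall n := by
  rw [Torus.mem_freqBall, freqNormSq_sn1Freq]

/-- `k₀ · z = 0` (transversality). [folklore] -/
theorem sn1_transversal (n : ℕ) : ∑ j, ((sn1Freq n j : ℤ) : ℂ) * sn1Vec j = 0 := by
  simp [sn1Freq, sn1Vec]

/-- `‖z‖² = 2A²`. [folklore] -/
theorem norm_sq_sn1Vec : ‖sn1Vec‖ ^ 2 = 2 * sn1Amp ^ 2 := by
  rw [EuclideanSpace.norm_sq_eq, Fin.sum_univ_three]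
  simp [sn1Vec, Complex.norm_real, abs_of_pos sn1Amp_pos]
  ring

/-- The witness mode is a Galerkin mode of order `n`. [folklore] -/
theorem isGalerkinMode_sn1Mode (n : ℕ) : IsGalerkinMode n (sn1Mode n) := by
  refine ⟨Torus.isSmooth_realTrigPoly _ _,
    Torus.isDivFree_realTrigPoly_singleton (sn1_transversal n),
    fun k' hk' => Torus.mFourierCoeff_realTrigPoly_singleton_eq_zero _ _ ?_⟩
  rw [freqNormSq_sn1Freq]; exact hk'

/-- `∫ ‖a‖² ≤ ‖z‖²`, hence kinetic energy `≤ A² ≤ 1`. [folklore] -/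
theorem kineticEnergy_sn1Mode_le (n : ℕ) : Torus.kineticEnergy (sn1Mode n) ≤ 1 := by
  have h := Torus.integral_norm_sq_realTrigPoly_singleton_le (sn1Freq n) (fun _ => sn1Vec)
  rw [norm_sq_sn1Vec, sn1Amp_sq] at h
  have hπ3 : (3 : ℝ) ^ 3 < Real.pi ^ 3 := by
    have := Real.pi_gt_three
    gcongr
  have hπ : (128 * Real.pi ^ 3)⁻¹ ≤ 1 := by
    rw [inv_le_one_iff₀]; right; linarith
  unfold Torus.kineticEnergy sn1Mode
  linarith

/-- `∫ ‖a‖² = A²` exactly (Parseval on the single mode, `n ≠ 0`). [folklore] -/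
theorem integral_norm_sq_sn1Mode {n : ℕ} (hn : n ≠ 0) :
    ∫ x, ‖sn1Mode n x‖ ^ 2 = sn1Amp ^ 2 := by
  have hint : Integrable (sn1Mode n) volume :=
    (Torus.continuous_realTrigPoly _ _).integrable_of_hasCompactSupport
      (HasCompactSupport.of_compactSpace _)
  have hne : sn1Freq n ≠ -sn1Freq n := by
    intro h; have := congr_fun h 2; simp [sn1Freq] at this; omega
  have h := Torus.integral_inner_realTrigPoly_singleton hint (sn1Freq n) (fun _ => sn1Vec)
  rw [sn1Mode, Torus.mFourierCoeff_realTrigPoly_singleton, if_pos rfl, if_neg hne,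
    EuclideanSpace.conjVec_zero, add_zero, inner_smul_left] at h
  have h1 : (⟪sn1Vec, sn1Vec⟫_ℂ).re = ‖sn1Vec‖ ^ 2 := by
    have := inner_self_eq_norm_sq (𝕜 := ℂ) sn1Vec
    simpa using this
  have hc : (starRingEnd ℂ) (2 : ℂ)⁻¹ = ((2⁻¹ : ℝ) : ℂ) := by
    rw [map_inv₀, map_ofNat]; norm_num
  rw [hc, Complex.re_ofReal_mul, h1, norm_sq_sn1Vec] at h
  simp_rw [real_inner_self_eq_norm_sq] at h
  rw [sn1Mode, h]; ring

/-- `d5` of the witness mode is exactly `n²` (`‖∇a‖² = 4π²n²A²`, `A² = 1/(128π³)`).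
[folklore] -/
theorem d5_sn1Mode {n : ℕ} (hn : n ≠ 0) : d5 (sn1Mode n) = (n : ℝ) ^ 2 := by
  have hs : Torus.IsSmooth (sn1Mode n) := Torus.isSmooth_realTrigPoly _ _
  have h := Torus.integral_inner_laplacian_self_eq_neg_gradNormSq_of_isSmooth hs
  have hlap : ∀ x, Torus.laplacian (sn1Mode n) x =
      -(4 * Real.pi ^ 2 * (n : ℝ) ^ 2) • sn1Mode n x := fun x => by
    rw [sn1Mode, Torus.laplacian_realTrigPoly_singleton, freqNormSq_sn1Freq]
  simp_rw [hlap, inner_smul_left, real_inner_self_eq_norm_sq] at h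
  rw [integral_const_mul, integral_norm_sq_sn1Mode hn] at h
  simp only [conj_trivial] at h
  rw [d5, show Torus.gradNormSq (sn1Mode n) = 4 * Real.pi ^ 2 * (n : ℝ) ^ 2 * sn1Amp ^ 2 by
    linarith, sn1Amp_sq]
  field_simp
  ring

/-! ## The complex-energy profile of the witness mode -/

/-- The imaginary direction scale `κ = 2πn e₃ ∈ ℝ³` (`⟪y, κ⟫ = 2πn y₃`). [folklore] -/
def sn1Kappa (n : ℕ) : E3 := EuclideanSpace.single 2 (2 * Real.pi * n)

/-- `⟪y, κ⟫ = 2πn · y₃`. [folklore] -/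
theorem inner_sn1Kappa (n : ℕ) (y : E3) : ⟪y, sn1Kappa n⟫ = 2 * Real.pi * n * y 2 := by
  rw [sn1Kappa, EuclideanSpace.inner_single_right]; simp

/-- `‖κ‖ = 2πn`. [folklore] -/
theorem norm_sn1Kappa (n : ℕ) : ‖sn1Kappa n‖ = 2 * Real.pi * n := by
  rw [sn1Kappa, PiLp.norm_single, Real.norm_eq_abs, abs_of_nonneg (by positivity)]

/-- `κ ≠ 0` for `n ≠ 0`. [folklore] -/
theorem sn1Kappa_ne_zero {n : ℕ} (hn : n ≠ 0) : sn1Kappa n ≠ 0 := by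
  rw [← norm_ne_zero_iff, norm_sn1Kappa]; positivity

/-- The phase `2π k₀ · y = ⟪y, κ⟫`. [folklore] -/
theorem sum_sn1Freq_mul (n : ℕ) (y : E3) :
    2 * Real.pi * ∑ j, ((sn1Freq n j : ℤ) : ℝ) * y j = ⟪y, sn1Kappa n⟫ := by
  rw [inner_sn1Kappa]; simp [sn1Freq]; ring

/-- Fourier coefficients of the witness mode: `z/2` at `k₀`, `z̄/2` at `−k₀`, `0` elsewhere.
[folklore] -/
theorem mFourierCoeff_sn1Mode (n : ℕ) (k : Fin 3 → ℤ) :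
    UnitAddTorus.mFourierCoeff (EuclideanSpace.complexify ∘ sn1Mode n) k =
      (if k = sn1Freq n then (2 : ℂ)⁻¹ • sn1Vec else 0) +
        (if k = -sn1Freq n then (2 : ℂ)⁻¹ • EuclideanSpace.conjVec sn1Vec else 0) := by
  rw [sn1Mode, Torus.mFourierCoeff_realTrigPoly_singleton]
  split_ifs <;> simp

/-- `|e_k(x)|² = 1`. [folklore] -/
theorem normSq_mFourier (k : Fin 3 → ℤ) (x : T3) :
    Complex.normSq (UnitAddTorus.mFourier k x) = 1 := by
  have h := Torus.mFourier_neg_mul k k x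
  rw [sub_self, UnitAddTorus.mFourier_neg] at h
  have h1 : (UnitAddTorus.mFourier (0 : Fin 3 → ℤ)) x = 1 := by
    rw [UnitAddTorus.mFourier_zero]; rfl
  rw [h1] at h
  exact_mod_cast (Complex.normSq_eq_conj_mul_self.trans h)

/-- The holomorphic extension of the witness mode: two Fourier modes. [folklore] -/
theorem holExt_sn1Mode (n : ℕ) (x : T3) (y : E3) :
    holExt n (sn1Mode n) x y =
      ((UnitAddTorus.mFourier (sn1Freq n) x : ℂ) * (Real.exp (-⟪y, sn1Kappa n⟫) : ℝ)) •
          ((2 : ℂ)⁻¹ • sn1Vec) +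
        ((starRingEnd ℂ) (UnitAddTorus.mFourier (sn1Freq n) x) *
            (Real.exp ⟪y, sn1Kappa n⟫ : ℝ)) •
          ((2 : ℂ)⁻¹ • EuclideanSpace.conjVec sn1Vec) := by
  have hmem : sn1Freq n ∈ Torus.freqBall n := sn1Freq_mem_freqBall n
  have hmem' : -sn1Freq n ∈ Torus.freqBall n := by rwa [Torus.neg_mem_freqBall]
  unfold holExt
  simp_rw [mFourierCoeff_sn1Mode, smul_add, Finset.sum_add_distrib, smul_ite, smul_zero,
    Finset.sum_ite_eq' (Torus.freqBall n), if_pos hmem, if_pos hmem']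
  congr 2
  · rw [← sum_sn1Freq_mul]
  · rw [UnitAddTorus.mFourier_neg, ← sum_sn1Freq_mul]
    congr 2
    push_cast
    simp only [Pi.neg_apply, Int.cast_neg, neg_mul, Finset.sum_neg_distrib, mul_neg, neg_neg]

/-- Imaginary parts of the two-mode combination:
`Im ½(e^{−S} p + e^{S} p̄) = −sinh S · Im p`. [folklore] -/
theorem im_twoMode (u w : ℂ) (S : ℝ) :
    (u * ((Real.exp (-S) : ℝ) : ℂ) * ((2 : ℂ)⁻¹ * w) +
        (starRingEnd ℂ) u * ((Real.exp S : ℝ) : ℂ) * ((2 : ℂ)⁻¹ * (starRingEnd ℂ) w)).im =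
      -Real.sinh S * (u * w).im := by
  have h2 : (2 : ℂ)⁻¹ = ((2⁻¹ : ℝ) : ℂ) := by norm_num
  rw [h2, Real.sinh_eq]
  simp only [Complex.add_im, Complex.mul_im, Complex.mul_re, Complex.ofReal_re,
    Complex.ofReal_im, Complex.conj_re, Complex.conj_im]
  ring

/-- The pointwise profile: `‖Im W(x + iy)‖² = A² sinh²⟪y, κ⟫`, independent of `x`.
[folklore] -/
theorem norm_sq_imExt_sn1Mode (n : ℕ) (x : T3) (y : E3) :
    ‖imExt n (sn1Mode n) x y‖ ^ 2 = sn1Amp ^ 2 * Real.sinh ⟪y, sn1Kappa n⟫ ^ 2 := by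
  have hu := normSq_mFourier (sn1Freq n) x
  rw [Complex.normSq_apply] at hu
  rw [imExt, EuclideanSpace.norm_sq_eq, Fin.sum_univ_three]
  simp only [Real.norm_eq_abs, sq_abs, holExt_sn1Mode, PiLp.add_apply, PiLp.smul_apply,
    smul_eq_mul, EuclideanSpace.conjVec_apply, im_twoMode]
  simp only [sn1Vec, Matrix.cons_val_zero, Matrix.cons_val_one, Matrix.cons_val_two,
    Matrix.tail_cons, Matrix.head_cons, Complex.mul_im, Complex.mul_re, Complex.ofReal_re,
    Complex.ofReal_im, Complex.I_re, Complex.I_im, Complex.neg_re, Complex.neg_im,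
    Complex.zero_re, Complex.zero_im]
  linear_combination sn1Amp ^ 2 * Real.sinh ⟪y, sn1Kappa n⟫ ^ 2 * hu

/-- The complex energy of the witness mode: `cE(ρ) = A² ∫_{B_ρ} sinh²⟪y, κ⟫ dy`
(the `x`-integral is over a probability space and the integrand is `x`-independent). [folklore] -/
theorem cE_sn1Mode (n : ℕ) :
    cE n (sn1Mode n) =
      fun ρ => sn1Amp ^ 2 * ∫ y in ball (0 : E3) ρ, Real.sinh ⟪y, sn1Kappa n⟫ ^ 2 := by
  funext ρ
  unfold cE
  simp_rw [norm_sq_imExt_sn1Mode, integral_const_mul]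
  simp [integral_const]

/-- The `ρ`-derivative of the complex energy of the witness mode (Archimedes projection,
`Literature.Analysis.Calculus.hasDerivAt_integral_ball_sinh_sq_inner`). [folklore] -/
theorem hasDerivAt_cE_sn1Mode {n : ℕ} (hn : n ≠ 0) {r : ℝ} (hr : 0 < r) :
    HasDerivAt (cE n (sn1Mode n))
      (sn1Amp ^ 2 * (2 * Real.pi * r *
        (Real.sinh (2 * ‖sn1Kappa n‖ * r) / (2 * ‖sn1Kappa n‖) - r))) r := by
  rw [cE_sn1Mode]
  exact (Literature.Analysis.Calculus.hasDerivAt_integral_ball_sinh_sq_inner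
    (sn1Kappa_ne_zero hn) hr).const_mul _

/-- `deriv` form of `hasDerivAt_cE_sn1Mode`, with `‖κ‖ = 2πn` substituted. [folklore] -/
theorem deriv_cE_sn1Mode {n : ℕ} (hn : n ≠ 0) {r : ℝ} (hr : 0 < r) :
    deriv (cE n (sn1Mode n)) r =
      sn1Amp ^ 2 * (2 * Real.pi * r *
        (Real.sinh (2 * (2 * Real.pi * n) * r) / (2 * (2 * Real.pi * n)) - r)) := by
  rw [(hasDerivAt_cE_sn1Mode hn hr).deriv, norm_sn1Kappa]

/-! ## The elementary inequality at `k = M¹⁶`, `δ = k^{-3/2} = M^{-24}` -/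

/-- `sinh s ≤ s + s³/6 + s⁵/100` on `[0, 1]` (Taylor, `Real.exp_bound` with `n = 5`).
[folklore] -/
theorem sinh_le_taylor {s : ℝ} (h0 : 0 ≤ s) (h1 : s ≤ 1) :
    Real.sinh s ≤ s + s ^ 3 / 6 + s ^ 5 / 100 := by
  have hs : |s| ≤ 1 := abs_le.2 ⟨by linarith, h1⟩
  have hs' : |(-s)| ≤ 1 := by rwa [abs_neg]
  have h₁ := Real.exp_bound hs (n := 5) (by norm_num)
  have h₂ := Real.exp_bound hs' (n := 5) (by norm_num)
  simp only [Finset.sum_range_succ, Finset.sum_range_zero, Nat.factorial] at h₁ h₂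
  rw [abs_of_nonneg h0] at h₁
  rw [abs_neg, abs_of_nonneg h0] at h₂
  norm_num at h₁ h₂
  have e1 := (abs_le.1 h₁).2
  have e2 := (abs_le.1 h₂).1
  rw [Real.sinh_eq]
  nlinarith [e1, e2]

/-- `(M¹⁶)^{-3/2} = M^{-24}` for `M > 0`. [folklore] -/
theorem sn1g_rpow_neg_three_halves {M : ℝ} (hM : 0 < M) :
    (M ^ 16) ^ (-(3 / 2 : ℝ)) = M⁻¹ ^ 24 := by
  rw [Real.rpow_neg (by positivity), inv_pow]
  congr 1
  rw [← Real.rpow_natCast M 16, ← Real.rpow_mul hM.le, ← Real.rpow_natCast M 24]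
  norm_num

/-- `(t²⁴)^{33/8} = t⁹⁹` for `t ≥ 0`. [folklore] -/
theorem sn1g_rpow_33_8 {t : ℝ} (ht : 0 ≤ t) : (t ^ 24) ^ (33 / 8 : ℝ) = t ^ 99 := by
  rw [← Real.rpow_natCast t 24, ← Real.rpow_mul ht, ← Real.rpow_natCast t 99]
  norm_num

/-- The decisive inequality: at `k = M¹⁶`, `δ = M^{-24}` (`M ≥ 2`) the `δ`-derivative of the
witness mode's complex energy, `A²·2πδ (sinh(4πM⁸δ)/(4πM⁸) − δ)`, does NOT exceed
`y′_k(δ) = (k/24)δ⁴ + (41/8)δ^{33/8} = M^{-80}/24 + (41/8)M^{-99}`: its excess over `M^{-80}/24`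
is at most `(π²/25)M^{-112}` (`sinh s ≤ s + s³/6 + s⁵/100` at `s = 4πM^{-16} ≤ 1`). [folklore] -/
theorem sn1_core {M : ℝ} (hM : 2 ≤ M) :
    sn1Amp ^ 2 * (2 * Real.pi * M⁻¹ ^ 24 *
        (Real.sinh (2 * (2 * Real.pi * M ^ 8) * M⁻¹ ^ 24) / (2 * (2 * Real.pi * M ^ 8)) -
          M⁻¹ ^ 24)) ≤
      M ^ 16 / 24 * (M⁻¹ ^ 24) ^ 4 + 41 / 8 * M⁻¹ ^ 99 := by
  have hM0 : 0 < M := by linarith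
  have hπ := Real.pi_pos
  have hπ0 : Real.pi ≠ 0 := hπ.ne'
  set t : ℝ := M⁻¹ with ht
  have ht0 : 0 < t := inv_pos.2 hM0
  have ht0' : t ≠ 0 := ht0.ne'
  have ht1 : t ≤ 1 / 2 := by rw [ht, one_div]; exact inv_anti₀ (by norm_num) hM
  have htle1 : t ≤ 1 := ht1.trans (by norm_num)
  have hMt : M * t = 1 := mul_inv_cancel₀ hM0.ne'
  have hM' : M = t⁻¹ := by rw [ht, inv_inv]
  have harg : 2 * (2 * Real.pi * M ^ 8) * t ^ 24 = 4 * Real.pi * t ^ 16 := by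
    have h8 : M ^ 8 * t ^ 24 = t ^ 16 := by
      have : M ^ 8 * t ^ 24 = (M * t) ^ 8 * t ^ 16 := by ring
      rw [this, hMt, one_pow, one_mul]
    linear_combination (4 * Real.pi) * h8
  rw [harg]
  set s : ℝ := 4 * Real.pi * t ^ 16 with hs
  have ht16 : t ^ 16 ≤ (1 / 2) ^ 16 := by gcongr
  have hs0 : 0 ≤ s := by positivity
  have hs1 : s ≤ 1 := by rw [hs]; nlinarith [Real.pi_lt_four, ht16]
  have hsinh := sinh_le_taylor hs0 hs1
  rw [hM', sn1Amp_sq]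
  have hL : (128 * Real.pi ^ 3)⁻¹ * (2 * Real.pi * t ^ 24 *
      (Real.sinh s / (2 * (2 * Real.pi * t⁻¹ ^ 8)) - t ^ 24)) =
      t ^ 32 * Real.sinh s / (256 * Real.pi ^ 3) - t ^ 48 / (64 * Real.pi ^ 2) := by
    field_simp
    ring
  have hR : t⁻¹ ^ 16 / 24 * (t ^ 24) ^ 4 + 41 / 8 * t ^ 99 =
      t ^ 80 / 24 + 41 / 8 * t ^ 99 := by
    field_simp
  rw [hL, hR]
  have h1 : t ^ 32 * Real.sinh s / (256 * Real.pi ^ 3) ≤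
      t ^ 32 * (s + s ^ 3 / 6 + s ^ 5 / 100) / (256 * Real.pi ^ 3) := by
    gcongr
  have h2 : t ^ 32 * (s + s ^ 3 / 6 + s ^ 5 / 100) / (256 * Real.pi ^ 3) -
      t ^ 48 / (64 * Real.pi ^ 2) = t ^ 80 / 24 + Real.pi ^ 2 * t ^ 112 / 25 := by
    rw [hs]; field_simp; ring
  have h3 : t ^ 112 ≤ t ^ 99 := pow_le_pow_of_le_one ht0.le htle1 (by norm_num)
  have h4 : Real.pi ^ 2 * t ^ 112 ≤ 16 * t ^ 112 :=
    mul_le_mul_of_nonneg_right (by nlinarith [Real.pi_lt_four, hπ]) (by positivity)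
  have h5 : (0 : ℝ) ≤ t ^ 99 := by positivity
  linarith [h1, h2, h3, h4, h5]

/-! ## The refutation -/

/-- **Refutation of `Step_SN1` = (5.13) p.35 l.14–22 at the carrier (Galerkin) grain**
(«Assume that ∂⁵E(0,t₀)/∂r⁵ ≥ k, then from Lemma 5.5 and inequality (5.9) follows, that for
sufficiently large k E_r(1/k^{3/2},t₀) > y′_k(1/k^{3/2})»). Countermodel for `B = 1` and every
threshold `k₀`: `M = max(2, ⌈k₀⌉)`, `k = M¹⁶`, `N = n = M⁸`, `a = sn1Mode n` — the circularly
polarised single Fourier mode `A (sin 2πn x₃, cos 2πn x₃, 0)`, `A² = 1/(128π³)`: a smooth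
divergence-free Galerkin mode of order `n`, kinetic energy `A²/2 ≤ 1`, `d5 a = n² = k ≥ k₀`, whose
complex energy is `E(ρ) = A² ∫_{B_ρ} sinh²(2πn y₃) dy` exactly (`cE_sn1Mode`), so that at
`δ = k^{−3/2} = M^{−24}`: `E′(δ) = A²·2πδ (sinh(4πnδ)/(4πn) − δ) ≤ (k/24)δ⁴ + (π²/25)M^{−112}
≤ (k/24)δ⁴ + (41/8)δ^{33/8} = y′_k(δ)` (`sn1_core`) — the printed strict `>` fails.
Classification: refuted-substantive at this grain (same exponent count as `not_Step_SN1_abs`: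
the inputs named on p.35 control the higher Taylor coefficients of `E` only at orders
`k²δ⁶ ≪ δ^{33/8}`); the charitable margin form (5.13)′ = `Step_513_margin` is TRUE (REF ref-3 g3)
and does not compose with Step 11 (VERDICT 04:50:04Z, ADJUDICATED #116). The row's locator
`Step_subsol` (5.18) p.36 is unchanged by this addendum.
[cite: Nadirashvili2026, §5 (5.13) p.35; HYGIENE 13] -/
theorem not_Step_SN1 : ¬ Literature.Claims.NS.Nadirashvili2026.Step_SN1 := by
  intro h
  obtain ⟨k₀, hk₀⟩ := h 1 zero_le_one
  obtain ⟨M, hM2, hMk⟩ : ∃ M : ℕ, 2 ≤ M ∧ k₀ ≤ (M : ℝ) :=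
    ⟨max 2 ⌈k₀⌉₊, le_max_left _ _,
      (Nat.le_ceil k₀).trans (by exact_mod_cast le_max_right 2 ⌈k₀⌉₊)⟩
  have hM0 : (0 : ℝ) < M := by exact_mod_cast (show 0 < M by omega)
  have hM1 : (1 : ℝ) ≤ M := by exact_mod_cast (show 1 ≤ M by omega)
  have hM2' : (2 : ℝ) ≤ M := by exact_mod_cast hM2
  have hn0 : M ^ 8 ≠ 0 := pow_ne_zero _ (by omega)
  have hk : k₀ ≤ (M : ℝ) ^ 16 := hMk.trans (le_self_pow₀ hM1 (by norm_num))
  have hd5 : (M : ℝ) ^ 16 ≤ d5 (sn1Mode (M ^ 8)) := by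
    rw [d5_sn1Mode hn0]; push_cast; ring_nf; exact le_rfl
  have key := hk₀ _ hk (M ^ 8) (sn1Mode (M ^ 8)) (isGalerkinMode_sn1Mode _)
    (kineticEnergy_sn1Mode_le _) hd5
  have hδ0 : (0 : ℝ) < (M : ℝ)⁻¹ ^ 24 := by positivity
  rw [sn1g_rpow_neg_three_halves hM0, deriv_cE_sn1Mode hn0 hδ0, dyk,
    sn1g_rpow_33_8 (inv_pos.2 hM0).le, Nat.cast_pow] at key
  exact absurd key (not_lt.2 (sn1_core hM2'))

end Summit.NavierStokesRegularity.NavierStokesRegularity.Theorems.Nadirashvili2026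

end
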